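import Summits.CriticalPhenomena.PercolationContinuityZ3.Theorems.PercNearOneGluingNoHeavyLowerTailAPLNonuniformSlack
import Summits.CriticalPhenomena.PercolationContinuityZ3.Theorems.PercNearOneGluingNoHeavyLowerTailAPLNonuniformStep
import HarnessLib


/-!
# `NoHeavyLowerTail` (stmt-CriticalPhenomena-4575) — the NON-UNIFORM reverse-Harris row APL on every finite weighted graph:
# `c_n · P(b ↮ c) · P(a ↔ b ∪ a ↔ c) ≤ P(ab|c) + P(ac|b)` with `c_n = 16K_{n-2}/(1+4K_{n-2})²`, `K_0 = 1/4`, `K_{m+1} = K_m/(1+16K_m²)`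

Support file (prover seat `prim-cert-1`, gen 16; `--supports stmt-CriticalPhenomena-4575`; memo
`run/shared/lean/prim/prim-cert-1/FROM-prim-cert-1-g16-APL-NONUNIFORM.md`).  No definitions, no named facts, no sorries.

THE ROW.  `μ = prodBernoulli w` on the pairs of `Fin n`, apex `a`, targets `b, c`; `e = P(ab|c) + P(ac|b)`, `D = P(b ↮ c)`,
`T = P(a ↔ b ∪ a ↔ c)`.  Harris: `e ≤ D·T`.  The lineage's conjecture APL(2/3) (prim-ineq-gen-8 / prove-5; files `…APLTriRegime`,
`…APLLightTargets`, `…APLSwitching`, …): `(2/3)·D·T ≤ e` on every finite weighted graph — OPEN.  prove-5 g37 (N) proved the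
non-uniform `c_n·D·T ≤ e`, `c_n ≈ 1.4/√n`, by apex elimination (memo prim-ineq-prove-5/FROM-prim-ineq-prove-5-g37-APL-STRUCTURE.md §3.5).

THIS FILE (`APL.apl_nonuniform`): the same scheme with two changes — (1) the per-instance choice of the dichotomy parameter
(`…APLNonuniformStep`: recursion `K ↦ K/(1+16K²)`, constants `c(K) = 16K/(1+4K)²`: `1, 8/9, .816, .763, …`, `≥ 3/10` up to 63 vertices,
`~ 2.8/√n`), and (2) NO CONTRACTION: the induction runs over GLUED APEX SETS `S` on the fixed vertex type (`S ↔ x := ∃ s ∈ S, s ↔ x`;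
`…APLNonuniformPaths/Fibres/Decoupling`), the step pins the pattern of the pairs crossing `∂S` (`pinW`, Kozma–Nitzan toolkit
`KozmaNitzanPinning`): for the pattern `ξ`, the glued cells of `S` under the pinned law are those of `S ∪ R(ξ)` (`R` = outside endpoints
of the open crossing pairs), so the induction hypothesis (on `|Sᶜ|`) applies; the loss of the step is `c₁·y·(1−T)` with
`y = μ(c ∉ T_b, b ↔ c through S)` (the pinned `D`-cells are `σ − x_ξ` with `σ = μ(c ∉ T_b)` pin-invariant), and the BHK slack
`u0·y ≤ uab·uac` is `APL.apexSet_bhk_slack`.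
* `APL.apl_nonuniform_glued` — for every `m`, every `S` with `|Sᶜ| ≤ m+1` and `b ≠ c ∉ S`: `c(K_m)·μ(ED)·μ(ET) ≤ μ(Eab) + μ(Eac)`
  (glued cells; `K` any sequence with `K_0 = 1/4`, `K_{m+1}(1+16K_m²) = K_m`);
* `APL.apl_nonuniform` — the vertex apex: `16K_{n-2}/(1+4K_{n-2})² · μ(b ↮ c) · μ(a↔b ∪ a↔c) ≤ μ(a↔b, a↮c) + μ(a↔c, a↮b)`.
HONEST LABEL: a theorem for every `n` with a constant decaying like `n^{-1/2}`; the uniform row (any constant `> 0.2046` suffices for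
the three-port `Z(3,2)`, `ThreePort.pocketExchange_of_apl`) remains OPEN.  [this work; scheme of prove-5 g37 (N)]
-/


noncomputable section

namespace Summit.CriticalPhenomena.PercolationContinuityZ3.Theorems

namespace APL

open MeasureTheory Literature.Probability.Percolation Literature.Probability.LatticeModels
open scoped Classical

/-! ### The induction step, the induction, and the vertex apex -/

section Main

variable {n : ℕ}

/-- **The induction step for a glued apex set.**  With `F` the crossing pairs of `S`, `ν_ξ` the pinned laws: if every pattern has
slack `c₁ ν_ξ(ED) ν_ξ(ET) ≤ ν_ξ(Eab) + ν_ξ(Eac)`, then `c₁(D·T − y(1−T)) ≤ e` with `y = μ(c ∉ T_b, b↔c ∪ (S↔b ∩ S↔c))`, and with the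
BHK slack `apexSet_bhk_slack` the algebra `nonuniform_step` gives `c₂·D·T ≤ e`. [this work] -/
theorem glued_step (w : Sym2 (Fin n) → unitInterval) (S : Finset (Fin n)) (b c : Fin n) (hb : b ∉ S) (hc : c ∉ S)
    (hbc : b ≠ c) {c₁ c₂ K : ℝ} (hc₁ : 0 < c₁) (hc₁1 : c₁ ≤ 1) (hc₂ : 0 < c₂) (hK : 0 < K)
    (hrec : 1 / c₁ + K ≤ 1 / c₂) (hdisc : c₂ * (1 + 4 * K) ^ 2 ≤ 16 * K)
    (hslack : ∀ ξ : Finset (Sym2 (Fin n)),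
      c₁ * (prodBernoulli (pinW w
          (↑(Finset.univ.filter fun e : Sym2 (Fin n) => (∃ x ∈ S, x ∈ e) ∧ ∃ y ∈ e, y ∉ S) : Set (Sym2 (Fin n))) ↑ξ)).real
          ((openConn b c)ᶜ ∩ ({ω : BondConfig (Fin n) | ∃ s ∈ (S : Set (Fin n)), ω ∈ openConn s b} ∩
            {ω | ∃ s ∈ (S : Set (Fin n)), ω ∈ openConn s c})ᶜ) *
        (prodBernoulli (pinW w
          (↑(Finset.univ.filter fun e : Sym2 (Fin n) => (∃ x ∈ S, x ∈ e) ∧ ∃ y ∈ e, y ∉ S) : Set (Sym2 (Fin n))) ↑ξ)).real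
          ({ω : BondConfig (Fin n) | ∃ s ∈ (S : Set (Fin n)), ω ∈ openConn s b} ∪
            {ω | ∃ s ∈ (S : Set (Fin n)), ω ∈ openConn s c}) ≤
      (prodBernoulli (pinW w
          (↑(Finset.univ.filter fun e : Sym2 (Fin n) => (∃ x ∈ S, x ∈ e) ∧ ∃ y ∈ e, y ∉ S) : Set (Sym2 (Fin n))) ↑ξ)).real
          ({ω : BondConfig (Fin n) | ∃ s ∈ (S : Set (Fin n)), ω ∈ openConn s b} ∩
            {ω | ∃ s ∈ (S : Set (Fin n)), ω ∈ openConn s c}ᶜ) +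
        (prodBernoulli (pinW w
          (↑(Finset.univ.filter fun e : Sym2 (Fin n) => (∃ x ∈ S, x ∈ e) ∧ ∃ y ∈ e, y ∉ S) : Set (Sym2 (Fin n))) ↑ξ)).real
          ({ω : BondConfig (Fin n) | ∃ s ∈ (S : Set (Fin n)), ω ∈ openConn s c} ∩
            {ω | ∃ s ∈ (S : Set (Fin n)), ω ∈ openConn s b}ᶜ)) :
    c₂ * (prodBernoulli w).real ((openConn b c)ᶜ ∩ ({ω : BondConfig (Fin n) | ∃ s ∈ (S : Set (Fin n)), ω ∈ openConn s b} ∩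
            {ω | ∃ s ∈ (S : Set (Fin n)), ω ∈ openConn s c})ᶜ) *
        (prodBernoulli w).real ({ω : BondConfig (Fin n) | ∃ s ∈ (S : Set (Fin n)), ω ∈ openConn s b} ∪
            {ω | ∃ s ∈ (S : Set (Fin n)), ω ∈ openConn s c}) ≤
      (prodBernoulli w).real ({ω : BondConfig (Fin n) | ∃ s ∈ (S : Set (Fin n)), ω ∈ openConn s b} ∩
            {ω | ∃ s ∈ (S : Set (Fin n)), ω ∈ openConn s c}ᶜ) +
        (prodBernoulli w).real ({ω : BondConfig (Fin n) | ∃ s ∈ (S : Set (Fin n)), ω ∈ openConn s c} ∩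
            {ω | ∃ s ∈ (S : Set (Fin n)), ω ∈ openConn s b}ᶜ) := by
  set F := (Finset.univ.filter fun e : Sym2 (Fin n) => (∃ x ∈ S, x ∈ e) ∧ ∃ y ∈ e, y ∉ S) with hF
  set SB : Set (BondConfig (Fin n)) := {ω | ∃ s ∈ (S : Set (Fin n)), ω ∈ openConn s b} with hSB
  set SC : Set (BondConfig (Fin n)) := {ω | ∃ s ∈ (S : Set (Fin n)), ω ∈ openConn s c} with hSC
  set D0 : Set (BondConfig (Fin n)) := {ω | c ∉ openCluster (ω ∩ {e | ∀ x ∈ e, x ∉ (S : Set (Fin n))}) b} with hD0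
  set XE : Set (BondConfig (Fin n)) := D0 ∩ (openConn b c ∪ (SB ∩ SC)) with hXE
  have hbS : b ∉ (S : Set (Fin n)) := fun h => hb (Finset.mem_coe.1 h)
  have hcS : c ∉ (S : Set (Fin n)) := fun h => hc (Finset.mem_coe.1 h)
  -- total probability over the patterns
  have tab := real_eq_sum_pin w S (SB ∩ SCᶜ)
  have tac := real_eq_sum_pin w S (SC ∩ SBᶜ)
  have tT := real_eq_sum_pin w S (SB ∪ SC)
  have tX := real_eq_sum_pin w S XE
  -- pin-invariance of `μ(c ∉ T_b)`
  have hD0pin : ∀ ξ : Finset (Sym2 (Fin n)),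
      (prodBernoulli (pinW w (↑F : Set (Sym2 (Fin n))) ↑ξ)).real D0 = (prodBernoulli w).real D0 := by
    intro ξ
    refine prodBernoulli_real_eq_of_determinedBy _ w (F := {e : Sym2 (Fin n) | ∀ x ∈ e, x ∉ (S : Set (Fin n))})
      (fun e he => pinW_apply_of_not_mem w _ fun heF => ?_) ?_ MeasurableSet.of_discrete
    · rw [hF, Finset.coe_filter] at heF
      obtain ⟨x, hxS, hxe⟩ := heF.2.1
      exact he x hxe (Finset.mem_coe.2 hxS)
    · rw [determinedBy_iff]
      intro ω ω' hω
      simp only [hD0, Set.mem_setOf_eq]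
      rw [hω]
  -- decomposition `μ(c ∉ T_b) = μ(ED) + μ(XE)` under every pinned law and under `μ`
  have hdec : ∀ v : Sym2 (Fin n) → unitInterval, (prodBernoulli v).real D0 =
      (prodBernoulli v).real ((openConn b c)ᶜ ∩ (SB ∩ SC)ᶜ) + (prodBernoulli v).real XE :=
    fun v => real_offD_eq_add b c v (S : Set (Fin n))
  -- abbreviations for the cells under `μ`
  have hT1 : (prodBernoulli w).real (SB ∪ SC) ≤ 1 := measureReal_le_one
  have hpart := real_gluedD_eq_add b c w (S : Set (Fin n))
  have hbhk := apexSet_bhk_slack w S b c hb hc hbc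
  -- the key estimate `c₁ (D T − Y (1 − T)) ≤ e`
  have h1 : c₁ * (((prodBernoulli w).real ((openConn b c)ᶜ ∩ (SB ∩ SC)ᶜ)) * (prodBernoulli w).real (SB ∪ SC) -
      (prodBernoulli w).real XE * (1 - (prodBernoulli w).real (SB ∪ SC))) ≤
      (prodBernoulli w).real (SB ∩ SCᶜ) + (prodBernoulli w).real (SC ∩ SBᶜ) := by
    -- `e = Σ π (νab + νac) ≥ Σ π c₁ νD νT ≥ c₁ Σ π (D0 νT − νXE) = c₁ (D0 T − Y)`
    have hsum : (prodBernoulli w).real (SB ∩ SCᶜ) + (prodBernoulli w).real (SC ∩ SBᶜ) ≥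
        ∑ ξ ∈ F.powerset, (prodBernoulli w).real (localCylinder (↑F : Set (Sym2 (Fin n))) ↑ξ) *
          (c₁ * ((prodBernoulli w).real D0 * (prodBernoulli (pinW w (↑F : Set (Sym2 (Fin n))) ↑ξ)).real (SB ∪ SC) -
            (prodBernoulli (pinW w (↑F : Set (Sym2 (Fin n))) ↑ξ)).real XE)) := by
      rw [tab, tac, ← Finset.sum_add_distrib]
      refine Finset.sum_le_sum fun ξ _ => ?_
      rw [← mul_add]
      refine mul_le_mul_of_nonneg_left ?_ measureReal_nonneg
      have hs := hslack ξ
      have hνT1 : (prodBernoulli (pinW w (↑F : Set (Sym2 (Fin n))) ↑ξ)).real (SB ∪ SC) ≤ 1 := measureReal_le_one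
      have hνT0 : 0 ≤ (prodBernoulli (pinW w (↑F : Set (Sym2 (Fin n))) ↑ξ)).real (SB ∪ SC) := measureReal_nonneg
      have hνX0 : 0 ≤ (prodBernoulli (pinW w (↑F : Set (Sym2 (Fin n))) ↑ξ)).real XE := measureReal_nonneg
      have hνD : (prodBernoulli (pinW w (↑F : Set (Sym2 (Fin n))) ↑ξ)).real ((openConn b c)ᶜ ∩ (SB ∩ SC)ᶜ) =
          (prodBernoulli w).real D0 - (prodBernoulli (pinW w (↑F : Set (Sym2 (Fin n))) ↑ξ)).real XE := by
        have := hdec (pinW w (↑F : Set (Sym2 (Fin n))) ↑ξ)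
        rw [hD0pin ξ] at this
        linarith
      rw [hνD] at hs
      nlinarith [mul_le_mul_of_nonneg_left hνT1 hνX0]
    have hsum2 : ∑ ξ ∈ F.powerset, (prodBernoulli w).real (localCylinder (↑F : Set (Sym2 (Fin n))) ↑ξ) *
          (c₁ * ((prodBernoulli w).real D0 * (prodBernoulli (pinW w (↑F : Set (Sym2 (Fin n))) ↑ξ)).real (SB ∪ SC) -
            (prodBernoulli (pinW w (↑F : Set (Sym2 (Fin n))) ↑ξ)).real XE)) =
        c₁ * ((prodBernoulli w).real D0 * (prodBernoulli w).real (SB ∪ SC) - (prodBernoulli w).real XE) := by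
      rw [tT, tX, Finset.mul_sum, ← Finset.sum_sub_distrib, Finset.mul_sum]
      refine Finset.sum_congr rfl fun ξ _ => ?_
      ring
    rw [hsum2] at hsum
    have hY := hdec w
    -- `D0 = D + Y`
    have : c₁ * (((prodBernoulli w).real ((openConn b c)ᶜ ∩ (SB ∩ SC)ᶜ)) * (prodBernoulli w).real (SB ∪ SC) -
        (prodBernoulli w).real XE * (1 - (prodBernoulli w).real (SB ∪ SC))) =
        c₁ * ((prodBernoulli w).real D0 * (prodBernoulli w).real (SB ∪ SC) - (prodBernoulli w).real XE) := by
      rw [hY]; ring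
    rw [this]
    exact hsum
  -- the algebra
  have h1' : c₁ * (((prodBernoulli w).real (SBᶜ ∩ SCᶜ ∩ (openConn b c)ᶜ) + (prodBernoulli w).real (SB ∩ SCᶜ) +
        (prodBernoulli w).real (SC ∩ SBᶜ)) * (prodBernoulli w).real (SB ∪ SC) -
      (prodBernoulli w).real XE * (1 - (prodBernoulli w).real (SB ∪ SC))) ≤
      (prodBernoulli w).real (SB ∩ SCᶜ) + (prodBernoulli w).real (SC ∩ SBᶜ) := by
    have e1 : (prodBernoulli w).real (SBᶜ ∩ SCᶜ ∩ (openConn b c)ᶜ) + (prodBernoulli w).real (SB ∩ SCᶜ) +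
        (prodBernoulli w).real (SC ∩ SBᶜ) = (prodBernoulli w).real ((openConn b c)ᶜ ∩ (SB ∩ SC)ᶜ) := by
      rw [hpart]; ring
    rw [e1]; exact h1
  have h2 : (prodBernoulli w).real XE * (prodBernoulli w).real (SBᶜ ∩ SCᶜ ∩ (openConn b c)ᶜ) ≤
      (prodBernoulli w).real (SB ∩ SCᶜ) * (prodBernoulli w).real (SC ∩ SBᶜ) := by
    rw [mul_comm]; exact hbhk
  have key := nonuniform_step measureReal_nonneg measureReal_nonneg measureReal_nonneg measureReal_nonneg hT1
    measureReal_nonneg hc₁ hc₁1 hc₂ hK hrec hdisc h1' h2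
  rw [hpart]
  calc c₂ * ((prodBernoulli w).real (SBᶜ ∩ SCᶜ ∩ (openConn b c)ᶜ) +
          ((prodBernoulli w).real (SB ∩ SCᶜ) + (prodBernoulli w).real (SC ∩ SBᶜ))) * (prodBernoulli w).real (SB ∪ SC)
        = c₂ * ((prodBernoulli w).real (SBᶜ ∩ SCᶜ ∩ (openConn b c)ᶜ) + (prodBernoulli w).real (SB ∩ SCᶜ) +
          (prodBernoulli w).real (SC ∩ SBᶜ)) * (prodBernoulli w).real (SB ∪ SC) := by ring
    _ ≤ _ := key

/-- **The non-uniform APL row for glued apex sets** (induction on `|Sᶜ|`): for any sequence `K` with `K 0 = 1/4`,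
`K (m+1) · (1 + 16 (K m)²) = K m`, every `S` with `|Sᶜ| ≤ m + 1` and `b ≠ c ∉ S`:
`16 K_m/(1+4K_m)² · μ(b ↮ c, ¬(S↔b ∧ S↔c)) · μ(S↔b ∪ S↔c) ≤ μ(S↔b, S↮c) + μ(S↔c, S↮b)`. [this work] -/
theorem apl_nonuniform_glued (K : ℕ → ℝ) (hK0 : K 0 = 1 / 4) (hKrec : ∀ m, K (m + 1) * (1 + 16 * K m ^ 2) = K m) :
    ∀ (m : ℕ) (w : Sym2 (Fin n) → unitInterval) (S : Finset (Fin n)) (b c : Fin n), b ∉ S → c ∉ S → b ≠ c →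
      (Finset.univ \ S).card ≤ m + 1 →
      16 * K m / (1 + 4 * K m) ^ 2 *
          (prodBernoulli w).real ((openConn b c)ᶜ ∩ ({ω : BondConfig (Fin n) | ∃ s ∈ (S : Set (Fin n)), ω ∈ openConn s b} ∩
            {ω | ∃ s ∈ (S : Set (Fin n)), ω ∈ openConn s c})ᶜ) *
        (prodBernoulli w).real ({ω : BondConfig (Fin n) | ∃ s ∈ (S : Set (Fin n)), ω ∈ openConn s b} ∪
            {ω | ∃ s ∈ (S : Set (Fin n)), ω ∈ openConn s c}) ≤
      (prodBernoulli w).real ({ω : BondConfig (Fin n) | ∃ s ∈ (S : Set (Fin n)), ω ∈ openConn s b} ∩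
            {ω | ∃ s ∈ (S : Set (Fin n)), ω ∈ openConn s c}ᶜ) +
        (prodBernoulli w).real ({ω : BondConfig (Fin n) | ∃ s ∈ (S : Set (Fin n)), ω ∈ openConn s c} ∩
            {ω | ∃ s ∈ (S : Set (Fin n)), ω ∈ openConn s b}ᶜ) := by
  have hKpos : ∀ m, 0 < K m := by
    intro m
    induction m with
    | zero => rw [hK0]; norm_num
    | succ m ih => exact K_next_pos ih (hKrec m)
  intro m
  induction m with
  | zero =>
    intro w S b c hb hc hbc hcard
    exfalso
    have h2 : ({b, c} : Finset (Fin n)) ⊆ Finset.univ \ S := by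
      intro x hx
      rw [Finset.mem_insert, Finset.mem_singleton] at hx
      rw [Finset.mem_sdiff]
      rcases hx with rfl | rfl
      · exact ⟨Finset.mem_univ _, hb⟩
      · exact ⟨Finset.mem_univ _, hc⟩
    have := Finset.card_le_card h2
    rw [Finset.card_pair hbc] at this
    omega
  | succ m ih =>
    intro w S b c hb hc hbc hcard
    have hc₁ : 0 < 16 * K m / (1 + 4 * K m) ^ 2 := cK_pos (hKpos m)
    have hc₁1 : 16 * K m / (1 + 4 * K m) ^ 2 ≤ 1 := cK_le_one (hKpos m)
    have hc₂ : 0 < 16 * K (m + 1) / (1 + 4 * K (m + 1)) ^ 2 := cK_pos (hKpos (m + 1))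
    have hrec : 1 / (16 * K m / (1 + 4 * K m) ^ 2) + K (m + 1) ≤ 1 / (16 * K (m + 1) / (1 + 4 * K (m + 1)) ^ 2) :=
      le_of_eq (cK_recursion (hKpos m) (hKrec m))
    have hdisc := cK_disc (hKpos (m + 1))
    refine glued_step w S b c hb hc hbc hc₁ hc₁1 hc₂ (hKpos (m + 1)) hrec hdisc fun ξ => ?_
    exact pattern_slack w S b c hb hc hc₁ hc₁1 (m := m) hcard (fun w' S' hb' hc' hcard' => ih w' S' b c hb' hc' hbc hcard') ξ

/-- **The non-uniform reverse-Harris row APL on every finite weighted graph** (vertex apex).  For any sequence `K` with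
`K 0 = 1/4`, `K (m+1)·(1 + 16 (K m)²) = K m` (so `c(K_1) = 8/9`, `c(K_2) = 0.816…`, …, `c(K_m) ~ 2.8/√m`), every `n`, every weight
function on the pairs of `Fin n` and distinct `a, b, c`:
`16 K_{n-2}/(1+4K_{n-2})² · P(b ↮ c) · P(a ↔ b ∪ a ↔ c) ≤ P(a↔b, a↮c) + P(a↔c, a↮b)`.  [this work; scheme of prove-5 g37 (N)] -/
theorem apl_nonuniform (K : ℕ → ℝ) (hK0 : K 0 = 1 / 4) (hKrec : ∀ m, K (m + 1) * (1 + 16 * K m ^ 2) = K m)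
    (w : Sym2 (Fin n) → unitInterval) (a b c : Fin n) (hab : a ≠ b) (hac : a ≠ c) (hbc : b ≠ c) :
    16 * K (n - 2) / (1 + 4 * K (n - 2)) ^ 2 * (prodBernoulli w).real (openConn b c)ᶜ *
        (prodBernoulli w).real (openConn a b ∪ openConn a c) ≤
      (prodBernoulli w).real (openConn a b ∩ (openConn a c)ᶜ) + (prodBernoulli w).real (openConn a c ∩ (openConn a b)ᶜ) := by
  have hSB : ∀ x : Fin n, {ω : BondConfig (Fin n) | ∃ s ∈ (({a} : Finset (Fin n)) : Set (Fin n)), ω ∈ openConn s x} =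
      openConn a x := by
    intro x; ext ω; simp
  have key := apl_nonuniform_glued K hK0 hKrec (n - 2) w {a} b c (by simpa using hab.symm) (by simpa using hac.symm) hbc
    (by rw [Finset.card_univ_sdiff, Fintype.card_fin, Finset.card_singleton]; omega)
  rw [hSB b, hSB c] at key
  have hED : ((openConn b c)ᶜ ∩ (openConn a b ∩ openConn a c)ᶜ : Set (BondConfig (Fin n))) = (openConn b c)ᶜ := by
    ext ω
    simp only [Set.mem_inter_iff, Set.mem_compl_iff, and_iff_left_iff_imp]
    intro hbc' h
    exact hbc' ((SimpleGraph.Reachable.symm (show (openGraph ω).Reachable a b from h.1)).trans h.2)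
  rw [hED] at key
  exact key

end Main

end APL

end Summit.CriticalPhenomena.PercolationContinuityZ3.Theorems

end
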